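import Mathlib
import HarnessLib
import HarnessLib.Audit.Tags

/-!
# `NoHeavyLowerTail` (crux stmt-CriticalPhenomena-4575), master-family line P1 (gen 17):
# the TRIPARTITION ULC LEMMA-CANDIDATE — ordered random tripartitions, one monotone property, three cells

Support file (seat `prim-masterthm-p1`, gen 17; `--supports stmt-CriticalPhenomena-4575`).
Memo `run/shared/lean/prim/prim-masterthm/FROM-prim-masterthm-p1-g17-TRIPARTITION-ULC.md`.

SETTING.  Fix a finite ground set `ι` and a Boolean property `u` of its subsets.  An ORDERED TRIPARTITION is
`(X, Y, Z)` with `X ⊔ Y ⊔ Z = univ` (we sum over `X` and `Y ⊆ Xᶜ`, `Z = Xᶜ \ Y`); `triCount u P` counts the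
tripartitions whose membership pattern `(u X, u Y, u Z)` satisfies `P`.  With `n_c = #{exactly c parts in u}` the
block statistics of gen 16's block calculus are `(d,a,b,g) = (n₀, n₁/3, n₂/3, n₃)`.

* THEOREM (`triCount_and_mul_le`, this file): for a MONOTONE `u`, `#{X ∈ u ∧ Y ∈ u} · #{all} ≤ #{X ∈ u} · #{Y ∈ u}`
  — two cells of a uniform random ordered tripartition are negatively correlated w.r.t. one increasing property
  (the degree-1 member `M₁² ≥ M₀M₂` of the chain below; an instance of Dubhashi–Ranjan negative association of
  balls-in-bins, proved here from Mathlib's `fkg` on the lattice `Finset ι` with weight `2^{|Xᶜ|}`).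
* CONJECTURE (`UnateTripartitionULC`, typed; = gen 16's lemma-candidate "tripartition statistics of unate Boolean
  functions are log-concave"): for every UNATE `u` (monotone after flipping a fixed set of coordinates),
  `3·n₀·n₂ ≤ n₁²` and `3·n₁·n₃ ≤ n₂²`, i.e. the number `N` of cells lying in `u` is ultra-log-concave of order 3.
  Equivalent forms (memo §1): `a² ≥ db ∧ b² ≥ ag`; `Cov(1_u(X),1_u(Y) | Z ∈ u) ≤ 0` and `… | Z ∉ u) ≤ 0`
  (conditional negative correlation = CNC = CNA for this exchangeable 3-cell measure, Pemantle 2000 Thm 2.7);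
  cumulative `M₂² ≥ M₁M₃`, `D₁² ≥ D₀D₂`.  CENSUS (exact, 0 failures): all unate `u` on ≤ 5 points (242 592 pairs
  (up-set, flip)), all 7 828 354 monotone `u` on 6 points, 1 200 random read-once unate formulas on ≤ 33 points,
  all thresholds `|x| ≥ r`, `r ≤ 4`, on ≤ 40 points; minimum of `a²/(db)` = 169/72 (the matching `x₁x₄ ∨ x₂x₃`).
  STRONGER (memo §2, same census + q = 2,4,5 cells): the generating polynomial `n₀ + n₁t + n₂t² + n₃t³` has only real
  roots (the 3-cell law is strongly Rayleigh) — for `u = "nonempty"` this is Vatutin–Mikhailov 1982; for thresholds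
  CNA is Kahn–Neiman (RSA 2012, arXiv 1001.0610) / Chan 2025 (arXiv 2509.06273); the present direction (an arbitrary
  monotone SET-property of the cell, equiprobable cells) is not covered there, and its "cross" versions are FALSE
  (two different properties; conditioning on a second up-set; non-exchangeable cell weights — explicit
  counterexamples in the memo §3), which rules out coordinate-induction / FKG-lattice / Holley proofs.
  PROVED SUB-CASES (memo §4, paper): read-once DNF with pairwise disjoint terms (all cell numbers q), via
  `D_u(k) = Π_i (1 − k·q^{-|A_i|})` and Hermite–Kakeya–Obreschkoff; every monotone `u` on ≤ 4 points (3 cells).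
* ROLE.  With gen 16's LC-EXMAX (log-concave exchangeable weights) the conjecture gives: block statistics of unate
  blocks are admissible weights, so LC-EXMAX ⟹ `PivotDichotomy` on every fibre of every block composite; the typed
  parent statement `ExchangeableLCClosed` (log-concave weights are closed under monotone substitution) is in the
  companion file `…SahiExchangeableLC`.
HONEST FRAMING: one proved inequality (degree 1), typed conjectures (degree 2 and real-rootedness); OPEN. [this work]
-/

namespace Summit.CriticalPhenomena.PercolationContinuityZ3.Theorems

namespace SahiTripartition

open Finset

variable {ι : Type*} [Fintype ι] [DecidableEq ι]

/-! ### 1. Counting ordered tripartitions by membership pattern -/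

/-- `triCount u P` = number of ordered tripartitions `(X, Y, Z = Xᶜ \ Y)` of the ground set whose membership
pattern `(u X, u Y, u Z)` satisfies the Boolean test `P`. [this work] -/
def triCount (u : Finset ι → Bool) (P : Bool → Bool → Bool → Bool) : ℕ :=
  ∑ x : Finset ι, ((xᶜ.powerset).filter fun y => P (u x) (u y) (u (xᶜ \ y)) = true).card

/-- `nParts u c` = number of ordered tripartitions with exactly `c` of the three parts in `u`. [this work] -/
def nParts (u : Finset ι → Bool) (c : ℕ) : ℕ :=
  triCount u fun a b d => (a.toNat + b.toNat + d.toNat == c)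

/-- Number of members of `u` inside `W`. [this work] -/
def inCount (u : Finset ι → Bool) (W : Finset ι) : ℕ := ((W.powerset).filter fun y => u y = true).card

/-- Number of non-members of `u` inside `W`. [this work] -/
def outCount (u : Finset ι → Bool) (W : Finset ι) : ℕ := ((W.powerset).filter fun y => u y = false).card

omit [Fintype ι] [DecidableEq ι] in
/-- `inCount + outCount = 2^{|W|}`. [this work] -/
theorem inCount_add_outCount (u : Finset ι → Bool) (W : Finset ι) :
    inCount u W + outCount u W = 2 ^ W.card := by
  unfold inCount outCount
  rw [← card_powerset]
  have h := card_filter_add_card_filter_not (s := W.powerset) (fun y => u y = true)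
  convert h using 3
  ext y; simp

/-! ### 2. The degree-1 inequality (negative correlation of two cells), proved -/

omit [Fintype ι] in
/-- For monotone `u` and windows `W, W'`: every non-member inside `W` restricts to a non-member inside `W'`, at most
`2^{|W \\ W'|}` to one (no inclusion between the windows is needed). [this work] -/
theorem outCount_le_mul (u : Finset ι → Bool) (hu : Monotone u) (W W' : Finset ι) :
    outCount u W ≤ 2 ^ (W \ W').card * outCount u W' := by
  classical
  unfold outCount
  set A := (W.powerset).filter fun y => u y = false with hA
  set B := (W'.powerset).filter fun y => u y = false with hB
  -- the restriction map y ↦ y ∩ W' sends A into B (a subset of a non-member is a non-member)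
  have hmaps : ∀ y ∈ A, y ∩ W' ∈ B := by
    intro y hy
    rw [hA, mem_filter, mem_powerset] at hy
    rw [hB, mem_filter, mem_powerset]
    refine ⟨inter_subset_right, ?_⟩
    have hle : u (y ∩ W') ≤ u y := hu inter_subset_left
    rw [hy.2] at hle
    exact le_antisymm (hle.trans (by decide)) (Bool.false_le _) |>.symm ▸ rfl
  have himg : A.image (fun y => y ∩ W') ⊆ B := by
    intro b hb
    obtain ⟨y, hy, rfl⟩ := mem_image.mp hb
    exact hmaps y hy
  -- fibres: y is determined by y ∩ W' together with y \ W' ⊆ W \ W'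
  have hfib : ∀ b ∈ A.image (fun y => y ∩ W'), (A.filter fun y => y ∩ W' = b).card ≤ 2 ^ (W \ W').card := by
    intro b _
    rw [← card_powerset]
    refine card_le_card_of_injOn (fun y => y \ W') (fun y hy => ?_) (fun y₁ hy₁ y₂ hy₂ heq => ?_)
    · rw [mem_coe, mem_filter, hA, mem_filter, mem_powerset] at hy
      rw [mem_coe, mem_powerset]
      exact sdiff_subset_sdiff hy.1.1 subset_rfl
    · rw [mem_coe, mem_filter] at hy₁ hy₂
      have e1 : y₁ ∩ W' ∪ y₁ \ W' = y₁ := sup_inf_sdiff y₁ W'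
      have e2 : y₂ ∩ W' ∪ y₂ \ W' = y₂ := sup_inf_sdiff y₂ W'
      have heq' : y₁ \ W' = y₂ \ W' := heq
      rw [← e1, ← e2, hy₁.2, hy₂.2, heq']
  calc A.card ≤ 2 ^ (W \ W').card * (A.image fun y => y ∩ W').card := card_le_mul_card_image _ _ hfib
    _ ≤ 2 ^ (W \ W').card * B.card := Nat.mul_le_mul_left _ (card_le_card himg)

omit [Fintype ι] in
/-- The density of non-members is antitone in the window: for `W' ⊆ W`,
`outCount W / 2^{|W|} ≤ outCount W' / 2^{|W'|}` (cross-multiplied). [this work] -/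
theorem outCount_mul_pow_le (u : Finset ι → Bool) (hu : Monotone u) {W W' : Finset ι} (h : W' ⊆ W) :
    outCount u W * 2 ^ W'.card ≤ outCount u W' * 2 ^ W.card := by
  have hc : (W \ W').card + W'.card = W.card := card_sdiff_add_card_eq_card h
  calc outCount u W * 2 ^ W'.card ≤ (2 ^ (W \ W').card * outCount u W') * 2 ^ W'.card :=
        Nat.mul_le_mul_right _ (outCount_le_mul u hu W W')
    _ = outCount u W' * 2 ^ W.card := by rw [← hc, pow_add]; ring

/-- Pattern counts as single sums. [this work] -/
theorem triCount_and_eq (u : Finset ι → Bool) :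
    triCount u (fun a b _ => a && b) = ∑ x : Finset ι, if u x = true then inCount u xᶜ else 0 := by
  unfold triCount inCount
  refine sum_congr rfl fun x _ => ?_
  rcases hx : u x with _ | _ <;> simp

/-- Pattern counts as single sums. [this work] -/
theorem triCount_true_eq (u : Finset ι → Bool) :
    triCount u (fun _ _ _ => true) = ∑ x : Finset ι, 2 ^ xᶜ.card := by
  unfold triCount
  refine sum_congr rfl fun x _ => ?_
  rw [filter_true_of_mem fun _ _ => rfl, card_powerset]

/-- Pattern counts as single sums. [this work] -/
theorem triCount_fst_eq (u : Finset ι → Bool) :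
    triCount u (fun a _ _ => a) = ∑ x : Finset ι, if u x = true then 2 ^ xᶜ.card else 0 := by
  unfold triCount
  refine sum_congr rfl fun x _ => ?_
  rcases hx : u x with _ | _ <;> simp [card_powerset]

/-- Pattern counts as single sums. [this work] -/
theorem triCount_snd_eq (u : Finset ι → Bool) :
    triCount u (fun _ b _ => b) = ∑ x : Finset ι, inCount u xᶜ := by
  unfold triCount inCount
  rfl

/-- **THEOREM (degree-1 member of the chain; two cells are negatively correlated).**  For a monotone property `u`
and a uniform random ordered tripartition `(X,Y,Z)` of a finite set: `P(X ∈ u ∧ Y ∈ u) ≤ P(X ∈ u)·P(Y ∈ u)`, i.e.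
`#{X,Y ∈ u}·#{all} ≤ #{X ∈ u}·#{Y ∈ u}`.  Proof: condition on `X`; the density of `u` in `2^{Xᶜ}` is antitone in `X`;
FKG on `Finset ι` with the log-modular weight `2^{|Xᶜ|}` (Mathlib `fkg`). [this work; Dubhashi–Ranjan NA instance] -/
theorem triCount_and_mul_le (u : Finset ι → Bool) (hu : Monotone u) :
    triCount u (fun a b _ => a && b) * triCount u (fun _ _ _ => true) ≤
      triCount u (fun a _ _ => a) * triCount u (fun _ b _ => b) := by
  classical
  -- the FKG data on the distributive lattice `Finset ι`
  set μ : Finset ι → ℚ := fun x => 2 ^ xᶜ.card with hμ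
  set f : Finset ι → ℚ := fun x => if u x = true then 1 else 0 with hf
  set g : Finset ι → ℚ := fun x => (outCount u xᶜ : ℚ) / 2 ^ xᶜ.card with hg
  have hμ0 : 0 ≤ μ := fun x => by positivity
  have hf0 : 0 ≤ f := fun x => by simp only [hf, Pi.zero_apply]; split_ifs <;> norm_num
  have hg0 : 0 ≤ g := fun x => by simp only [hg, Pi.zero_apply]; positivity
  have hfm : Monotone f := by
    intro x y hxy
    simp only [hf]
    split_ifs with h1 h2 <;> norm_num
    exact absurd (le_antisymm (Bool.le_true _) (h1 ▸ hu hxy)) h2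
  have hgm : Monotone g := by
    intro x y hxy
    simp only [hg]
    have hsub : yᶜ ⊆ xᶜ := compl_subset_compl.mpr hxy
    have key := outCount_mul_pow_le u hu hsub
    rw [div_le_div_iff₀ (by positivity) (by positivity)]
    exact_mod_cast key
  have hμl : ∀ a b, μ a * μ b ≤ μ (a ⊓ b) * μ (a ⊔ b) := by
    intro a b
    simp only [hμ, ← pow_add]
    apply le_of_eq
    congr 1
    rw [inf_eq_inter, sup_eq_union, compl_inter, compl_union, add_comm (aᶜ ∪ bᶜ).card,
      card_inter_add_card_union]
  have FKG := fkg (μ := μ) (f := f) (g := g) hμ0 hf0 hg0 hfm hgm hμl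
  -- identify the four sums
  have hout : ∀ x : Finset ι, (outCount u xᶜ : ℚ) = 2 ^ xᶜ.card - inCount u xᶜ := by
    intro x
    have := inCount_add_outCount u xᶜ
    have h' : ((inCount u xᶜ + outCount u xᶜ : ℕ) : ℚ) = ((2 ^ xᶜ.card : ℕ) : ℚ) := by rw [this]
    push_cast at h'
    linarith
  have s1 : ∑ x, μ x * f x = ∑ x : Finset ι, if u x = true then (2 : ℚ) ^ xᶜ.card else 0 := by
    refine sum_congr rfl fun x _ => ?_; simp only [hμ, hf]; split_ifs <;> ring
  have s2 : ∑ x, μ x * g x = ∑ x : Finset ι, ((2 : ℚ) ^ xᶜ.card - inCount u xᶜ) := by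
    refine sum_congr rfl fun x _ => ?_
    simp only [hμ, hg]
    rw [mul_div_cancel₀ _ (by positivity), hout]
  have s3 : ∑ x, μ x = ∑ x : Finset ι, (2 : ℚ) ^ xᶜ.card := rfl
  have s4 : ∑ x, μ x * (f x * g x) = ∑ x : Finset ι, if u x = true then ((2 : ℚ) ^ xᶜ.card - inCount u xᶜ) else 0 := by
    refine sum_congr rfl fun x _ => ?_
    simp only [hμ, hf, hg]
    split_ifs
    · rw [one_mul, mul_div_cancel₀ _ (by positivity), hout]
    · ring
  rw [s1, s2, s3, s4] at FKG
  -- rewrite the target in ℚ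
  rw [triCount_and_eq, triCount_true_eq, triCount_fst_eq, triCount_snd_eq]
  have e11 : ((∑ x : Finset ι, if u x = true then inCount u xᶜ else 0 : ℕ) : ℚ)
      = ∑ x : Finset ι, if u x = true then (inCount u xᶜ : ℚ) else 0 := by
    push_cast; refine sum_congr rfl fun x _ => ?_; split_ifs <;> simp
  have e10 : ((∑ x : Finset ι, if u x = true then 2 ^ xᶜ.card else 0 : ℕ) : ℚ)
      = ∑ x : Finset ι, if u x = true then (2 : ℚ) ^ xᶜ.card else 0 := by
    push_cast; refine sum_congr rfl fun x _ => ?_; split_ifs <;> simp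
  have e00 : ((∑ x : Finset ι, 2 ^ xᶜ.card : ℕ) : ℚ) = ∑ x : Finset ι, (2 : ℚ) ^ xᶜ.card := by push_cast; rfl
  have e01 : ((∑ x : Finset ι, inCount u xᶜ : ℕ) : ℚ) = ∑ x : Finset ι, (inCount u xᶜ : ℚ) := by push_cast; rfl
  -- sums split
  have split2 : ∑ x : Finset ι, ((2 : ℚ) ^ xᶜ.card - inCount u xᶜ)
      = ∑ x : Finset ι, (2 : ℚ) ^ xᶜ.card - ∑ x : Finset ι, (inCount u xᶜ : ℚ) := sum_sub_distrib _ _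
  have split4 : ∑ x : Finset ι, (if u x = true then ((2 : ℚ) ^ xᶜ.card - inCount u xᶜ) else 0)
      = (∑ x : Finset ι, if u x = true then (2 : ℚ) ^ xᶜ.card else 0)
        - ∑ x : Finset ι, if u x = true then (inCount u xᶜ : ℚ) else 0 := by
    rw [← sum_sub_distrib]; refine sum_congr rfl fun x _ => ?_; split_ifs <;> ring
  rw [split2, split4] at FKG
  have goal : ((∑ x : Finset ι, if u x = true then inCount u xᶜ else 0 : ℕ) : ℚ) * ((∑ x : Finset ι, 2 ^ xᶜ.card : ℕ) : ℚ)
      ≤ ((∑ x : Finset ι, if u x = true then 2 ^ xᶜ.card else 0 : ℕ) : ℚ) * ((∑ x : Finset ι, inCount u xᶜ : ℕ) : ℚ) := by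
    rw [e11, e10, e00, e01]
    nlinarith [FKG]
  exact_mod_cast goal

/-! ### 3. The typed lemma-candidate (degree 2) and its real-rooted strengthening -/

/-- **CONJECTURE (tripartition ULC; typed).**  For every finite set and every UNATE property `u` of its subsets, the
number `N ∈ {0,1,2,3}` of cells of a uniform random ordered tripartition that lie in `u` is ultra-log-concave of
order 3 (`u` unate = monotone after flipping the coordinates in `t`): `3·n₀·n₂ ≤ n₁²` and `3·n₁·n₃ ≤ n₂²`.  Equivalently (memo §1) the block statistics `(d,a,b,g) = (n₀,n₁/3,n₂/3,n₃)`
of gen 16's block calculus satisfy `a² ≥ db`, `b² ≥ ag`; equivalently `X ∈ u`, `Y ∈ u` are negatively correlated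
given `Z ∈ u` and given `Z ∉ u`.  Census and proved sub-cases in the file header; OPEN. [this work] [status: open] -/
@[conjecture] def UnateTripartitionULC : Prop :=
  ∀ (n : ℕ) (u : Finset (Fin n) → Bool) (t : Finset (Fin n)), Monotone (fun x => u (symmDiff x t)) →
    3 * nParts u 0 * nParts u 2 ≤ nParts u 1 ^ 2 ∧ 3 * nParts u 1 * nParts u 3 ≤ nParts u 2 ^ 2

/-- **CONJECTURE (real-rootedness / strong Rayleigh; typed, stronger).**  For unate `u` the cubic
`n₀ + n₁ t + n₂ t² + n₃ t³` has only real roots — stated as nonnegativity of its discriminant (all coefficients are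
nonnegative, so this is equivalent); implies `UnateTripartitionULC` by Newton's inequalities.  For `u = "nonempty"` this
is Vatutin–Mikhailov's theorem on empty cells; census as in the header (also for 2, 4, 5 cells). [this work]
[status: open] -/
@[conjecture] def UnateTripartitionRealRooted : Prop :=
  ∀ (n : ℕ) (u : Finset (Fin n) → Bool) (t : Finset (Fin n)), Monotone (fun x => u (symmDiff x t)) →
    let n₀ : ℤ := nParts u 0; let n₁ : ℤ := nParts u 1; let n₂ : ℤ := nParts u 2; let n₃ : ℤ := nParts u 3
    0 ≤ 18 * n₃ * n₂ * n₁ * n₀ - 4 * n₂ ^ 3 * n₀ + n₂ ^ 2 * n₁ ^ 2 - 4 * n₃ * n₁ ^ 3 - 27 * n₃ ^ 2 * n₀ ^ 2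

end SahiTripartition

end Summit.CriticalPhenomena.PercolationContinuityZ3.Theorems
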